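import Summits.CriticalPhenomena.PercolationContinuityZ3.Theorems.PercLevyKhintchineSmallPNegTypeLogKernels
import HarnessLib

/-!
# `PercLevyKhintchine.SmallPNegType` (stmt-CriticalPhenomena-2171) — kernel lemmas III: strict positivity on the null
# directions for distinct points, and the compactness step

RSW3 lane (lead, gen 30).  Sequel of `…SmallPNegTypeKernels` / `…SmallPNegTypeLogKernels` (helper lemmas for item 2171).

`exists_forall_neg_mul_add_pos`: the COMPACTNESS STEP (on a compact `S`, `A ≤ 0` and `B > 0` on `{A = 0}` give `−tA + B > 0`
on `S` for `t ≥ t₀`); `sum_sum_mul_inv_one_add_pos`: for injective `x`, `c ≠ 0`, `μ > 0`, `Σ c_i c_j/(1+μ‖x_i−x_j‖₁) > 0` (the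
integrand of part II is `≥ e^{−u} Σ c_i²/2` for large `u`); hence `sum_sum_mul_log_one_add_neg` (`Σ c_i c_j log(1+‖x_i−x_j‖₁) < 0`,
`Σ c = 0`) and `sum_sum_mul_log_factorial_pos` (`Σ c_i c_j log(‖x_i−x_j‖₁!) > 0` on the null directions; the `k = 0` term of the
Euler product).  With parts I–II this is the complete KERNEL SIDE of the small-`p` argument
`Σ c_i c_j log τ_p = |log p|·(−A) + B + O(p)`; what remains for the item is `log τ_p(x,y) = ‖x−y‖₁ log p + log N(x−y) + O(p)`
(path counting).  No definitions, no sorries.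
References: C. Berg, J. P. R. Christensen, P. Ressel (1984), Ch. 3 §2 [BergChristensenRessel1984]; M. Deza, M. Laurent (1997), §6.1 [DezaLaurent1997].
-/

noncomputable section

namespace Summit.CriticalPhenomena.PercolationContinuityZ3.Theorems

namespace SmallPNegType

open Finset Literature.Probability.LatticeModels

/-! ### Part III: strict positivity on the null directions (distinct points) and the compactness step -/

/-- **Compactness step.**  On a compact set `S`: if `A ≤ 0` on `S` and `B > 0` wherever `A = 0`, then for all large `t`,
`−t·A + B > 0` on `S` (minimise `B` on `S` and `−A` on the compact set `S ∩ {B ≤ 0}`). [folklore] -/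
theorem exists_forall_neg_mul_add_pos {V : Type*} [TopologicalSpace V] {S : Set V} (hS : IsCompact S)
    {A B : V → ℝ} (hA : Continuous A) (hB : Continuous B)
    (hA0 : ∀ c ∈ S, A c ≤ 0) (hAB : ∀ c ∈ S, A c = 0 → 0 < B c) :
    ∃ t₀ : ℝ, 0 ≤ t₀ ∧ ∀ t : ℝ, t₀ ≤ t → ∀ c ∈ S, 0 < -(t * A c) + B c := by
  set S₀ : Set V := S ∩ B ⁻¹' Set.Iic 0 with hS₀def
  have hS₀ : IsCompact S₀ := hS.inter_right (isClosed_Iic.preimage hB)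
  by_cases hne0 : S₀.Nonempty
  · obtain ⟨cA, hcA, hAmin⟩ := hS₀.exists_isMinOn hne0 (hA.neg.continuousOn : ContinuousOn (fun c => -A c) S₀)
    obtain ⟨cB, hcB, hBmin⟩ := hS.exists_isMinOn ⟨cA, hcA.1⟩ hB.continuousOn
    have hδ : 0 < -A cA := by
      have h1 : A cA ≤ 0 := hA0 cA hcA.1
      have h2 : B cA ≤ 0 := hcA.2
      rcases eq_or_lt_of_le h1 with h | h
      · exact absurd (hAB cA hcA.1 h) (not_lt.2 h2)
      · linarith
    refine ⟨(|B cB| + 1) / (-A cA), by positivity, fun t ht c hc => ?_⟩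
    have ht0 : 0 ≤ t := le_trans (by positivity) ht
    by_cases hBc : B c ≤ 0
    · have hc0 : c ∈ S₀ := ⟨hc, hBc⟩
      have h1 : -A cA ≤ -A c := (isMinOn_iff.1 hAmin) c hc0
      have h2 : B cB ≤ B c := (isMinOn_iff.1 hBmin) c hc
      have h3 : (|B cB| + 1) / (-A cA) * (-A cA) = |B cB| + 1 := div_mul_cancel₀ _ hδ.ne'
      have h4 : (|B cB| + 1) / (-A cA) * (-A cA) ≤ t * (-A c) :=
        mul_le_mul ht h1 hδ.le ht0
      have h5 := neg_abs_le (B cB)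
      linarith
    · push Not at hBc
      have : 0 ≤ t * (-A c) := mul_nonneg ht0 (by linarith [hA0 c hc])
      linarith
  · refine ⟨0, le_rfl, fun t ht c hc => ?_⟩
    have hBc : 0 < B c := by
      by_contra h; push Not at h; exact hne0 ⟨c, hc, h⟩
    have : 0 ≤ t * (-A c) := mul_nonneg ht (by linarith [hA0 c hc])
    linarith

/-- Distinct points of `ℤ³` are at `ℓ¹`-distance at least one. [folklore] -/
theorem one_le_l1_of_ne {x y : Site 3} (h : x ≠ y) : 1 ≤ ∑ k, (x k - y k).natAbs := by
  obtain ⟨k, hk⟩ : ∃ k, x k ≠ y k := by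
    by_contra hall; push Not at hall; exact h (funext hall)
  have h1 : 1 ≤ (x k - y k).natAbs := by
    have : x k - y k ≠ 0 := sub_ne_zero.2 hk
    omega
  exact le_trans h1 (Finset.single_le_sum (f := fun k => (x k - y k).natAbs) (fun k _ => Nat.zero_le _)
    (Finset.mem_univ k))

/-- **Strict positivity of `1/(1+μ‖x−y‖₁)` on distinct points**: for `x` injective, `c ≠ 0` and `μ > 0`,
`Σ_{i,j} c_i c_j / (1 + μ‖x_i − x_j‖₁) > 0` (in the integral representation the integrand `e^{−u} Σ c_i c_j e^{−μu‖x_i−x_j‖₁}` is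
non-negative and at least `e^{−u} Σ c_i²/2` for large `u`). [cite: BergChristensenRessel1984, Ch. 3, §2] -/
theorem sum_sum_mul_inv_one_add_pos {n : ℕ} (x : Fin n → Site 3) (hx : Function.Injective x) (c : Fin n → ℝ)
    (hc0 : c ≠ 0) {μ : ℝ} (hμ : 0 < μ) :
    0 < ∑ i, ∑ j, c i * c j * (1 + μ * ((∑ k, (x i k - x j k).natAbs : ℕ) : ℝ))⁻¹ := by
  set d : Fin n → Fin n → ℕ := fun i j => ∑ k, (x i k - x j k).natAbs with hd
  have hexp : ∀ (m : ℕ) (u : ℝ), Real.exp (-u) * Real.exp (-(μ * u)) ^ m = Real.exp (-(1 + μ * m) * u) := by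
    intro m u; rw [← Real.exp_nat_mul, ← Real.exp_add]; congr 1; ring
  have hrep : ∀ m : ℕ, (1 + μ * (m : ℝ))⁻¹ = ∫ u in Set.Ioi (0 : ℝ), Real.exp (-u) * Real.exp (-(μ * u)) ^ m := by
    intro m
    have hpos : 0 < 1 + μ * (m : ℝ) := by positivity
    simp_rw [hexp m]
    rw [integral_exp_mul_Ioi (by linarith) 0, mul_zero, Real.exp_zero, neg_div_neg_eq, one_div]
  have hint : ∀ i j, MeasureTheory.IntegrableOn
      (fun u : ℝ => c i * c j * (Real.exp (-u) * Real.exp (-(μ * u)) ^ d i j)) (Set.Ioi 0) := by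
    intro i j
    have hpos : 0 < 1 + μ * (d i j : ℝ) := by positivity
    have h1 : (fun u : ℝ => c i * c j * (Real.exp (-u) * Real.exp (-(μ * u)) ^ d i j)) =
        fun u => c i * c j * Real.exp (-(1 + μ * (d i j : ℝ)) * u) := by
      funext u; rw [hexp]
    rw [h1]
    exact (exp_neg_integrableOn_Ioi 0 hpos).const_mul _
  set F : ℝ → ℝ := fun u => ∑ i, ∑ j, c i * c j * (Real.exp (-u) * Real.exp (-(μ * u)) ^ d i j) with hF
  have hFint : MeasureTheory.IntegrableOn F (Set.Ioi 0) :=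
    MeasureTheory.integrable_finsetSum _ fun i _ => MeasureTheory.integrable_finsetSum _ fun j _ => hint i j
  have hFeq : ∀ u, F u = Real.exp (-u) * ∑ i, ∑ j, c i * c j * Real.exp (-(μ * u)) ^ d i j := by
    intro u
    simp only [hF, Finset.mul_sum]
    refine Finset.sum_congr rfl fun i _ => Finset.sum_congr rfl fun j _ => ?_
    ring
  have hF0 : ∀ u, 0 < u → 0 ≤ F u := by
    intro u hu
    rw [hFeq]
    refine mul_nonneg (Real.exp_pos _).le (sum_sum_mul_pow_l1_nonneg x c ?_ ?_)
    · exact Real.exp_le_one_iff.2 (by nlinarith)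
    · linarith [Real.exp_pos (-(μ * u))]
  have hval : ∑ i, ∑ j, c i * c j * (1 + μ * (d i j : ℝ))⁻¹ = ∫ u in Set.Ioi (0 : ℝ), F u := by
    rw [MeasureTheory.integral_finsetSum _ fun i _ => MeasureTheory.integrable_finsetSum _ fun j _ => hint i j]
    refine Finset.sum_congr rfl fun i _ => ?_
    rw [MeasureTheory.integral_finsetSum _ fun j _ => hint i j]
    refine Finset.sum_congr rfl fun j _ => ?_
    rw [MeasureTheory.integral_const_mul, hrep]
  set s2 : ℝ := ∑ i, c i ^ 2 with hs2
  set s1 : ℝ := ∑ i, |c i| with hs1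
  have hs2pos : 0 < s2 := by
    obtain ⟨i, hi⟩ : ∃ i, c i ≠ 0 := by
      by_contra hall; push Not at hall; exact hc0 (funext hall)
    exact lt_of_lt_of_le (by positivity : 0 < c i ^ 2)
      (Finset.single_le_sum (f := fun i => c i ^ 2) (fun i _ => sq_nonneg _) (Finset.mem_univ i))
  have hs1nn : 0 ≤ s1 := Finset.sum_nonneg fun i _ => abs_nonneg _
  have hG : ∀ u, 0 ≤ u → s2 - Real.exp (-(μ * u)) * s1 ^ 2 ≤ ∑ i, ∑ j, c i * c j * Real.exp (-(μ * u)) ^ d i j := by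
    intro u hu
    set r := Real.exp (-(μ * u)) with hr
    have hr0 : 0 ≤ r := (Real.exp_pos _).le
    have hr1 : r ≤ 1 := Real.exp_le_one_iff.2 (by nlinarith)
    have hterm : ∀ i j, (if i = j then c i ^ 2 else 0) - |c i| * |c j| * r ≤ c i * c j * r ^ d i j := by
      intro i j
      by_cases h : i = j
      · subst h
        have hdi : d i i = 0 := by simp [hd]
        rw [if_pos rfl, hdi, pow_zero]
        nlinarith [abs_nonneg (c i), sq_abs (c i)]
      · rw [if_neg h, zero_sub]
        have hd1 : 1 ≤ d i j := one_le_l1_of_ne (fun heq => h (hx heq))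
        have hrd : r ^ d i j ≤ r := by
          calc r ^ d i j ≤ r ^ 1 := pow_le_pow_of_le_one hr0 hr1 hd1
            _ = r := pow_one r
        have h1 : -(|c i| * |c j| * r ^ d i j) ≤ c i * c j * r ^ d i j := by
          rw [← abs_mul]
          nlinarith [neg_abs_le (c i * c j), pow_nonneg hr0 (d i j), abs_nonneg (c i * c j)]
        have h2 : |c i| * |c j| * r ^ d i j ≤ |c i| * |c j| * r := mul_le_mul_of_nonneg_left hrd (by positivity)
        linarith
    have ha : ∑ i, ∑ j, (if i = j then c i ^ 2 else (0 : ℝ)) = s2 := by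
      rw [hs2]
      refine Finset.sum_congr rfl fun i _ => ?_
      rw [Finset.sum_ite_eq]
      simp
    have hb : ∑ i, ∑ j, |c i| * |c j| * r = r * s1 ^ 2 := by
      rw [hs1, sq, Finset.sum_mul_sum, Finset.mul_sum]
      refine Finset.sum_congr rfl fun i _ => ?_
      rw [Finset.mul_sum]
      refine Finset.sum_congr rfl fun j _ => ?_
      ring
    calc s2 - r * s1 ^ 2 = ∑ i, ∑ j, ((if i = j then c i ^ 2 else 0) - |c i| * |c j| * r) := by
          simp only [Finset.sum_sub_distrib, ha, hb]
      _ ≤ _ := Finset.sum_le_sum fun i _ => Finset.sum_le_sum fun j _ => hterm i j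
  set U₀ : ℝ := 2 * s1 ^ 2 / (μ * s2) + 1 with hU₀
  have hU₀pos : 0 < U₀ := by positivity
  have hsmall : ∀ u, U₀ ≤ u → Real.exp (-(μ * u)) * s1 ^ 2 ≤ s2 / 2 := by
    intro u hu
    have hu0 : 0 < u := lt_of_lt_of_le hU₀pos hu
    have hμu : 0 < μ * u := by positivity
    have h1 : Real.exp (-(μ * u)) ≤ (μ * u)⁻¹ := by
      have := Real.add_one_le_exp (μ * u)
      rw [Real.exp_neg, inv_le_inv₀ (Real.exp_pos _) hμu]
      linarith
    have h2 : 2 * s1 ^ 2 ≤ s2 * (μ * u) := by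
      have h3 : 2 * s1 ^ 2 / (μ * s2) ≤ u := by linarith
      rw [div_le_iff₀ (by positivity)] at h3
      nlinarith
    calc Real.exp (-(μ * u)) * s1 ^ 2 ≤ (μ * u)⁻¹ * s1 ^ 2 := mul_le_mul_of_nonneg_right h1 (by positivity)
      _ ≤ s2 / 2 := by
          rw [inv_mul_le_iff₀ hμu]
          linarith
  set m₀ : ℝ := Real.exp (-(U₀ + 1)) * (s2 / 2) with hm₀
  have hm₀pos : 0 < m₀ := by positivity
  have hlow : ∀ u ∈ Set.Icc U₀ (U₀ + 1), m₀ ≤ F u := by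
    intro u hu
    rw [hFeq]
    have h1 : Real.exp (-(U₀ + 1)) ≤ Real.exp (-u) := Real.exp_le_exp.2 (by linarith [hu.2])
    have h2 : s2 / 2 ≤ ∑ i, ∑ j, c i * c j * Real.exp (-(μ * u)) ^ d i j := by
      have := hG u (le_trans hU₀pos.le hu.1)
      have := hsmall u hu.1
      linarith
    calc m₀ = Real.exp (-(U₀ + 1)) * (s2 / 2) := rfl
      _ ≤ Real.exp (-u) * (s2 / 2) := mul_le_mul_of_nonneg_right h1 (by positivity)
      _ ≤ _ := mul_le_mul_of_nonneg_left h2 (Real.exp_pos _).le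
  rw [hval]
  have hsub : Set.Icc U₀ (U₀ + 1) ⊆ Set.Ioi 0 := fun u hu => lt_of_lt_of_le hU₀pos hu.1
  have h1 : ∫ u in Set.Icc U₀ (U₀ + 1), F u ≤ ∫ u in Set.Ioi (0 : ℝ), F u :=
    MeasureTheory.setIntegral_mono_set hFint
      (MeasureTheory.ae_restrict_of_forall_mem measurableSet_Ioi fun u hu => hF0 u hu) hsub.eventuallyLE
  have h2 : m₀ * MeasureTheory.volume.real (Set.Icc U₀ (U₀ + 1)) ≤ ∫ u in Set.Icc U₀ (U₀ + 1), F u :=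
    MeasureTheory.setIntegral_ge_of_const_le_real measurableSet_Icc (by simp) hlow (hFint.mono_set hsub)
  have h3 : MeasureTheory.volume.real (Set.Icc U₀ (U₀ + 1)) = 1 := by
    rw [MeasureTheory.measureReal_def, Real.volume_Icc, ENNReal.toReal_ofReal (by linarith)]
    ring
  rw [h3, mul_one] at h2
  linarith

/-- **Strict negative type of `log(1 + ‖x−y‖₁)` on distinct points**: for `x` injective, `Σ c_i = 0` and `c ≠ 0`,
`Σ_{i,j} c_i c_j log(1 + ‖x_i − x_j‖₁) < 0`. [cite: BergChristensenRessel1984, Ch. 3, §2] -/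
theorem sum_sum_mul_log_one_add_neg {n : ℕ} (x : Fin n → Site 3) (hx : Function.Injective x) (c : Fin n → ℝ)
    (hc : ∑ i, c i = 0) (hc0 : c ≠ 0) :
    ∑ i, ∑ j, c i * c j * Real.log (1 + ((∑ k, (x i k - x j k).natAbs : ℕ) : ℝ)) < 0 := by
  set d : Fin n → Fin n → ℕ := fun i j => ∑ k, (x i k - x j k).natAbs with hd
  have hlog : ∀ s : ℝ, 0 ≤ s → Real.log (1 + s) = ∫ v in (0 : ℝ)..1, s / (1 + v * s) := by
    intro s hs
    have hderiv : ∀ v ∈ Set.uIcc (0 : ℝ) 1, HasDerivAt (fun v => Real.log (1 + v * s)) (s / (1 + v * s)) v := by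
      intro v hv
      rw [Set.uIcc_of_le zero_le_one] at hv
      have hpos : 0 < 1 + v * s := by have := hv.1; positivity
      have h := (((hasDerivAt_id v).mul_const s).const_add 1).log hpos.ne'
      simp only [id, one_mul] at h
      exact h
    have hcont : IntervalIntegrable (fun v => s / (1 + v * s)) MeasureTheory.volume 0 1 := by
      refine ContinuousOn.intervalIntegrable ?_
      rw [Set.uIcc_of_le zero_le_one]
      refine continuousOn_const.div (by fun_prop) fun v hv => ?_
      have := hv.1
      positivity
    rw [intervalIntegral.integral_eq_sub_of_hasDerivAt hderiv hcont]
    simp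
  have hterm : ∀ i j, c i * c j * Real.log (1 + (d i j : ℝ)) =
      ∫ v in (0 : ℝ)..1, c i * c j * ((d i j : ℝ) / (1 + v * d i j)) := by
    intro i j
    rw [hlog _ (by positivity), intervalIntegral.integral_const_mul]
  have hcont_ij : ∀ i j, ContinuousOn (fun v : ℝ => c i * c j * ((d i j : ℝ) / (1 + v * d i j))) (Set.Icc 0 1) := by
    intro i j
    refine continuousOn_const.mul (continuousOn_const.div (by fun_prop) fun v hv => ?_)
    have := hv.1
    positivity
  have hii : ∀ i j, IntervalIntegrable (fun v : ℝ => c i * c j * ((d i j : ℝ) / (1 + v * d i j)))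
      MeasureTheory.volume 0 1 := by
    intro i j
    refine ContinuousOn.intervalIntegrable ?_
    rw [Set.uIcc_of_le zero_le_one]
    exact hcont_ij i j
  set G : ℝ → ℝ := fun v => ∑ i, ∑ j, c i * c j * ((d i j : ℝ) / (1 + v * d i j)) with hGdef
  have hGii : IntervalIntegrable G MeasureTheory.volume 0 1 := by
    have h := IntervalIntegrable.sum Finset.univ fun i (_ : i ∈ Finset.univ) =>
      IntervalIntegrable.sum Finset.univ fun j (_ : j ∈ Finset.univ) => hii i j
    simpa only [Finset.sum_fn, hGdef] using h
  have hswap : ∑ i, ∑ j, c i * c j * Real.log (1 + (d i j : ℝ)) = ∫ v in (0 : ℝ)..1, G v := by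
    have hrow : ∀ i, IntervalIntegrable (fun v : ℝ => ∑ j, c i * c j * ((d i j : ℝ) / (1 + v * d i j)))
        MeasureTheory.volume 0 1 := by
      intro i
      have h := IntervalIntegrable.sum Finset.univ fun j (_ : j ∈ Finset.univ) => hii i j
      simpa only [Finset.sum_fn] using h
    rw [hGdef, intervalIntegral.integral_finsetSum fun i _ => hrow i]
    refine Finset.sum_congr rfl fun i _ => ?_
    rw [intervalIntegral.integral_finsetSum fun j _ => hii i j]
    exact Finset.sum_congr rfl fun j _ => hterm i j
  have hGneg : ∀ v ∈ Set.Ioo (0 : ℝ) 1, 0 < -G v := by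
    intro v hv
    have hv0 : 0 < v := hv.1
    have hid : ∀ i j, c i * c j * ((d i j : ℝ) / (1 + v * d i j)) =
        v⁻¹ * (c i * c j) - v⁻¹ * (c i * c j * (1 + v * (d i j : ℝ))⁻¹) := by
      intro i j
      have hpos : 0 < 1 + v * (d i j : ℝ) := by positivity
      field_simp
      ring
    have hA : ∑ i, ∑ j, v⁻¹ * (c i * c j) = v⁻¹ * ((∑ i, c i) * ∑ j, c j) := by
      rw [Finset.sum_mul_sum, Finset.mul_sum]; exact Finset.sum_congr rfl fun i _ => by rw [Finset.mul_sum]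
    have hB : ∑ i, ∑ j, v⁻¹ * (c i * c j * (1 + v * (d i j : ℝ))⁻¹) =
        v⁻¹ * ∑ i, ∑ j, c i * c j * (1 + v * (d i j : ℝ))⁻¹ := by
      rw [Finset.mul_sum]; exact Finset.sum_congr rfl fun i _ => by rw [Finset.mul_sum]
    have hGv : G v = -(v⁻¹ * ∑ i, ∑ j, c i * c j * (1 + v * (d i j : ℝ))⁻¹) := by
      calc G v = ∑ i, ∑ j, (v⁻¹ * (c i * c j) - v⁻¹ * (c i * c j * (1 + v * (d i j : ℝ))⁻¹)) :=
            Finset.sum_congr rfl fun i _ => Finset.sum_congr rfl fun j _ => hid i j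
        _ = v⁻¹ * ((∑ i, c i) * ∑ j, c j) - v⁻¹ * ∑ i, ∑ j, c i * c j * (1 + v * (d i j : ℝ))⁻¹ := by
            simp only [Finset.sum_sub_distrib, hA, hB]
        _ = _ := by rw [hc, zero_mul, mul_zero, zero_sub]
    rw [hGv, neg_neg]
    exact mul_pos (inv_pos.2 hv0) (sum_sum_mul_inv_one_add_pos x hx c hc0 hv0)
  rw [hswap]
  have hnegint : 0 < ∫ v in (0 : ℝ)..1, -G v :=
    intervalIntegral.intervalIntegral_pos_of_pos_on hGii.neg hGneg zero_lt_one
  rw [intervalIntegral.integral_neg] at hnegint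
  linarith

/-- **Strict positivity on the null directions (distinct points).**  If `x` is injective, `Σ c_i = 0`, `c ≠ 0` and all
axis-level sums of `c` vanish, then `Σ_{i,j} c_i c_j log(‖x_i − x_j‖₁ !) > 0`: the `k = 0` term `−Σ c_i c_j log(1+‖x_i−x_j‖₁)`
of the truncated Euler product is already strictly positive. [cite: BergChristensenRessel1984, Ch. 3, §2] -/
theorem sum_sum_mul_log_factorial_pos {n : ℕ} (x : Fin n → Site 3) (hx : Function.Injective x) (c : Fin n → ℝ)
    (hc : ∑ i, c i = 0) (hc0 : c ≠ 0)
    (hlev : ∀ (k : Fin 3) (v : ℤ), ∑ i ∈ Finset.univ.filter (fun i => x i k = v), c i = 0) :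
    0 < ∑ i, ∑ j, c i * c j * Real.log ((∑ k, (x i k - x j k).natAbs).factorial : ℝ) := by
  set d : Fin n → Fin n → ℕ := fun i j => ∑ k, (x i k - x j k).natAbs with hd
  have hlin : ∑ i, ∑ j, c i * c j * (d i j : ℝ) = 0 := by
    have h1 : ∀ i j, c i * c j * (d i j : ℝ) = ∑ k, c i * c j * (((x i k - x j k).natAbs : ℕ) : ℝ) := by
      intro i j
      simp only [hd, Nat.cast_sum, Finset.mul_sum]
    simp_rw [h1]
    calc ∑ i, ∑ j, ∑ k, c i * c j * (((x i k - x j k).natAbs : ℕ) : ℝ)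
        = ∑ i, ∑ k, ∑ j, c i * c j * (((x i k - x j k).natAbs : ℕ) : ℝ) := Finset.sum_congr rfl fun i _ => Finset.sum_comm
      _ = ∑ k, ∑ i, ∑ j, c i * c j * (((x i k - x j k).natAbs : ℕ) : ℝ) := Finset.sum_comm
      _ = 0 := Finset.sum_eq_zero fun k _ =>
          sum_sum_coord_eq_zero x c k (hlev k) (fun a b => (((a - b).natAbs : ℕ) : ℝ))
  set T : ℝ := -(∑ i, ∑ j, c i * c j * Real.log (1 + (d i j : ℝ))) with hT
  have hTpos : 0 < T := by
    rw [hT, neg_pos]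
    have h := sum_sum_mul_log_one_add_neg x hx c hc hc0
    exact h
  set C : ℝ := ∑ i, ∑ j, |c i| * |c j| * ((d i j : ℝ) * d i j) with hC
  have hC0 : 0 ≤ C := Finset.sum_nonneg fun i _ => Finset.sum_nonneg fun j _ => by positivity
  have hrem : ∀ (N : ℕ), 1 ≤ N → ∀ m : ℕ, 0 ≤ ∑ j ∈ Finset.range m, Real.log (1 + ((j : ℝ) + 1) / N) ∧
      ∑ j ∈ Finset.range m, Real.log (1 + ((j : ℝ) + 1) / N) ≤ (m : ℝ) * m / N := by
    intro N hN m
    have hN0 : (0 : ℝ) < N := by exact_mod_cast hN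
    constructor
    · exact Finset.sum_nonneg fun j _ => Real.log_nonneg (by
        have : (0 : ℝ) ≤ ((j : ℝ) + 1) / N := by positivity
        linarith)
    · calc ∑ j ∈ Finset.range m, Real.log (1 + ((j : ℝ) + 1) / N) ≤ ∑ j ∈ Finset.range m, ((m : ℝ) / N) := by
            refine Finset.sum_le_sum fun j hj => ?_
            have hj' : (j : ℝ) + 1 ≤ m := by exact_mod_cast Finset.mem_range.1 hj
            calc Real.log (1 + ((j : ℝ) + 1) / N) ≤ (1 + ((j : ℝ) + 1) / N) - 1 :=
                  Real.log_le_sub_one_of_pos (by positivity)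
              _ = ((j : ℝ) + 1) / N := by ring
              _ ≤ (m : ℝ) / N := by gcongr
        _ = (m : ℝ) * m / N := by rw [Finset.sum_const, Finset.card_range, nsmul_eq_mul]; ring
  have hmain : ∀ N : ℕ, 1 ≤ N → T - C / N ≤ ∑ i, ∑ j, c i * c j * Real.log ((d i j).factorial : ℝ) := by
    intro N hN
    have hN0 : (0 : ℝ) < N := by exact_mod_cast hN
    have hid : ∀ i j, c i * c j * Real.log ((d i j).factorial : ℝ) =
        -(c i * c j * ∑ k ∈ Finset.range N, Real.log (1 + ((k : ℝ) + 1)⁻¹ * d i j)) +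
          Real.log N * (c i * c j * (d i j : ℝ)) +
          c i * c j * ∑ j' ∈ Finset.range (d i j), Real.log (1 + ((j' : ℝ) + 1) / N) := by
      intro i j
      rw [log_factorial_eq_sum (d i j) hN]
      ring
    have hsum : ∑ i, ∑ j, c i * c j * Real.log ((d i j).factorial : ℝ) =
        -(∑ i, ∑ j, c i * c j * ∑ k ∈ Finset.range N, Real.log (1 + ((k : ℝ) + 1)⁻¹ * d i j)) +
          Real.log N * ∑ i, ∑ j, c i * c j * (d i j : ℝ) +
          ∑ i, ∑ j, c i * c j * ∑ j' ∈ Finset.range (d i j), Real.log (1 + ((j' : ℝ) + 1) / N) := by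
      simp only [hid, Finset.sum_add_distrib, Finset.sum_neg_distrib, ← Finset.mul_sum]
    rw [hsum, hlin, mul_zero, add_zero]
    have hswap : ∑ i, ∑ j, c i * c j * ∑ k ∈ Finset.range N, Real.log (1 + ((k : ℝ) + 1)⁻¹ * d i j) =
        ∑ k ∈ Finset.range N, ∑ i, ∑ j, c i * c j * Real.log (1 + ((k : ℝ) + 1)⁻¹ * d i j) := by
      calc ∑ i, ∑ j, c i * c j * ∑ k ∈ Finset.range N, Real.log (1 + ((k : ℝ) + 1)⁻¹ * d i j)
          = ∑ i, ∑ j, ∑ k ∈ Finset.range N, c i * c j * Real.log (1 + ((k : ℝ) + 1)⁻¹ * d i j) :=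
            Finset.sum_congr rfl fun i _ => Finset.sum_congr rfl fun j _ => by rw [Finset.mul_sum]
        _ = ∑ i, ∑ k ∈ Finset.range N, ∑ j, c i * c j * Real.log (1 + ((k : ℝ) + 1)⁻¹ * d i j) :=
            Finset.sum_congr rfl fun i _ => Finset.sum_comm
        _ = ∑ k ∈ Finset.range N, ∑ i, ∑ j, c i * c j * Real.log (1 + ((k : ℝ) + 1)⁻¹ * d i j) :=
            Finset.sum_comm
    have h1 : T ≤ -(∑ i, ∑ j, c i * c j * ∑ k ∈ Finset.range N, Real.log (1 + ((k : ℝ) + 1)⁻¹ * d i j)) := by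
      rw [hswap]
      obtain ⟨N', rfl⟩ : ∃ N', N = N' + 1 := ⟨N - 1, by omega⟩
      rw [Finset.sum_range_succ']
      have hrest : ∑ k ∈ Finset.range N', ∑ i, ∑ j, c i * c j *
          Real.log (1 + ((((k + 1 : ℕ) : ℝ)) + 1)⁻¹ * d i j) ≤ 0 :=
        Finset.sum_nonpos fun k _ => sum_sum_mul_log_one_add_nonpos x c hc (by positivity)
      have hzero : ∑ i, ∑ j, c i * c j * Real.log (1 + ((((0 : ℕ) : ℝ)) + 1)⁻¹ * d i j) = -T := by
        rw [hT, neg_neg]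
        refine Finset.sum_congr rfl fun i _ => Finset.sum_congr rfl fun j _ => ?_
        norm_num
      rw [hzero]
      linarith
    have h2 : -(C / N) ≤ ∑ i, ∑ j, c i * c j * ∑ j' ∈ Finset.range (d i j), Real.log (1 + ((j' : ℝ) + 1) / N) := by
      rw [hC, Finset.sum_div, ← Finset.sum_neg_distrib]
      refine Finset.sum_le_sum fun i _ => ?_
      rw [Finset.sum_div, ← Finset.sum_neg_distrib]
      refine Finset.sum_le_sum fun j _ => ?_
      obtain ⟨hr0, hr1⟩ := hrem N hN (d i j)
      have habs : |c i * c j * ∑ j' ∈ Finset.range (d i j), Real.log (1 + ((j' : ℝ) + 1) / N)| ≤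
          |c i| * |c j| * ((d i j : ℝ) * d i j / N) := by
        rw [abs_mul, abs_mul, abs_of_nonneg hr0]
        exact mul_le_mul_of_nonneg_left hr1 (by positivity)
      have := neg_abs_le (c i * c j * ∑ j' ∈ Finset.range (d i j), Real.log (1 + ((j' : ℝ) + 1) / N))
      have e : -(|c i| * |c j| * ((d i j : ℝ) * d i j) / N) = -(|c i| * |c j| * ((d i j : ℝ) * d i j / N)) := by ring
      linarith
    linarith
  obtain ⟨N, hN⟩ := exists_nat_gt (2 * C / T)
  have hN1 : 1 ≤ N + 1 := by omega
  have h := hmain (N + 1) hN1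
  have hNpos : (0 : ℝ) < (N + 1 : ℕ) := by positivity
  have hCN : C / ((N + 1 : ℕ) : ℝ) ≤ T / 2 := by
    rw [div_le_iff₀ hNpos]
    have h2 : 2 * C / T < (N : ℝ) + 1 := by linarith
    rw [div_lt_iff₀ hTpos] at h2
    push_cast
    nlinarith
  linarith

/-- Distinct sites of `ℤ³` are at positive `ℓ¹`-distance (re-commit corollary of `one_le_l1_of_ne`). [folklore] -/ theorem l1_pos_of_ne {x y : Site 3} (h : x ≠ y) : 0 < ∑ k, (x k - y k).natAbs := one_le_l1_of_ne h
end SmallPNegType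

end Summit.CriticalPhenomena.PercolationContinuityZ3.Theorems

end
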